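import Mathlib
import Summits.NavierStokesRegularity.NavierStokesRegularity.Theorems.ThreadingFluxAzimuthalCartanDefs
import Summits.NavierStokesRegularity.NavierStokesRegularity.Theorems.ThreadingFluxCentreJetAnalyticPrimitive
import HarnessLib

/-!
# Crux `PoloidalLiouville` (stmt-NavierStokesRegularity-1222, wall W1), crux idea «azimuthal-cartan-test» (ns-idea-15 g10):
# THE AXIAL PROFILE `G_γ` OF THE SECTORIAL CROSS FLOW (K♭) — FTC, the ODE, analyticity

Support file (`--supports stmt-NavierStokesRegularity-1222`, helper; cell `ns-wall-extremal`, width hand ns-wall-eng-7 g7, 0 kit).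
`crossFlowAxial γ r = ∫₂^r e^{−γ log²s}/s ds` (Defs twin, imported): on `r > 0`,

* `hasDerivAt_crossFlowAxial` — `G′(r) = g(r) := e^{−γ log²r}/r` (FTC, the integrand is continuous on `(0, ∞)`);
* `hasDerivAt_axialIntegrand` — `g′(r) = −g(r)(2γ log r + 1)/r`, i.e. the ODE `G″ + (1 + 2γ log ρ) G′/ρ = 0` of the card;
* `analyticAt_axialIntegrand`, `analyticOnNhd_crossFlowAxial` — `g` is analytic, hence so is its primitive `G` (ns-wall-eng-7 g5's
  `CentreJet.analyticOnNhd_of_fderiv`: differentiable with analytic derivative ⇒ analytic);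
* `axialIntegrand_pos` — `g(r) > 0`.

HONEST FRAME: one-variable calculus; closes no crux or sketch Prop; `PoloidalLiouville` (1222) and NS regularity OPEN.
-/

-- the summit and its single sub-problem share the name (CONVENTIONS §1)
set_option linter.dupNamespace false

noncomputable section

namespace Summit.NavierStokesRegularity.NavierStokesRegularity.Theorems.PoloidalLiouville.AzimuthalCartan.Axial

open Set Function Filter Topology Metric MeasureTheory
open scoped ContDiff
open Summit.NavierStokesRegularity.NavierStokesRegularity.Theorems.PoloidalLiouville.CentreJet (analyticOnNhd_of_fderiv)

variable (γ : ℝ)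

/-- The integrand `g(s) = e^{−γ log²s}/s` is continuous on `(0, ∞)`. -/
theorem continuousOn_axialIntegrand : ContinuousOn (fun s : ℝ => Real.exp (-(γ * Real.log s ^ 2)) / s) (Ioi 0) := by
  refine ContinuousOn.div ?_ continuousOn_id fun s hs => (ne_of_gt hs)
  refine (Real.continuous_exp.comp_continuousOn ?_)
  exact ((continuousOn_const.mul ((Real.continuousOn_log.mono fun s hs => ne_of_gt hs).pow 2)).neg)

/-- The integrand is analytic on `(0, ∞)`. -/
theorem analyticAt_axialIntegrand {r : ℝ} (hr : 0 < r) :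
    AnalyticAt ℝ (fun s : ℝ => Real.exp (-(γ * Real.log s ^ 2)) / s) r := by
  have hlog : AnalyticAt ℝ Real.log r := (Real.contDiffAt_log (n := ω) |>.2 hr.ne').analyticAt
  have hexp : AnalyticAt ℝ (fun s : ℝ => Real.exp (-(γ * Real.log s ^ 2))) r :=
    (analyticAt_const.mul (hlog.pow 2)).neg.rexp
  exact hexp.div analyticAt_id hr.ne'

/-- The integrand is positive on `(0, ∞)`. -/
theorem axialIntegrand_pos {r : ℝ} (hr : 0 < r) : 0 < Real.exp (-(γ * Real.log r ^ 2)) / r :=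
  div_pos (Real.exp_pos _) hr

/-- **FTC for the axial profile**: `G′(r) = e^{−γ log²r}/r` for `r > 0`. -/
theorem hasDerivAt_crossFlowAxial {r : ℝ} (hr : 0 < r) :
    HasDerivAt (crossFlowAxial γ) (Real.exp (-(γ * Real.log r ^ 2)) / r) r := by
  have e : crossFlowAxial γ = fun u => ∫ s in (2 : ℝ)..u, Real.exp (-(γ * Real.log s ^ 2)) / s := rfl
  rw [e]
  have hcont := continuousOn_axialIntegrand γ
  have hsub : uIcc (2 : ℝ) r ⊆ Ioi 0 := fun s hs => by
    rcases mem_uIcc.1 hs with ⟨h1, _⟩ | ⟨h1, _⟩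
    · exact lt_of_lt_of_le two_pos h1
    · exact lt_of_lt_of_le hr h1
  have hint : IntervalIntegrable (fun s : ℝ => Real.exp (-(γ * Real.log s ^ 2)) / s) volume 2 r :=
    (hcont.mono hsub).intervalIntegrable
  have hmeas : StronglyMeasurableAtFilter (fun s : ℝ => Real.exp (-(γ * Real.log s ^ 2)) / s) (𝓝 r) :=
    hcont.stronglyMeasurableAtFilter isOpen_Ioi r hr
  exact intervalIntegral.integral_hasDerivAt_right hint hmeas (hcont.continuousAt (Ioi_mem_nhds hr))

/-- The axial profile is differentiable on `(0, ∞)`. -/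
theorem differentiableOn_crossFlowAxial : DifferentiableOn ℝ (crossFlowAxial γ) (Ioi 0) := fun _ hr =>
  (hasDerivAt_crossFlowAxial γ hr).differentiableAt.differentiableWithinAt

/-- `fderiv` of the axial profile. -/
theorem fderiv_crossFlowAxial {r : ℝ} (hr : 0 < r) :
    fderiv ℝ (crossFlowAxial γ) r = (Real.exp (-(γ * Real.log r ^ 2)) / r) • (1 : ℝ →L[ℝ] ℝ) := by
  rw [(hasDerivAt_crossFlowAxial γ hr).hasFDerivAt.fderiv]
  ext
  simp

/-- **The axial profile is analytic on `(0, ∞)`** (a primitive of an analytic function). -/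
theorem analyticOnNhd_crossFlowAxial : AnalyticOnNhd ℝ (crossFlowAxial γ) (Ioi 0) := by
  refine analyticOnNhd_of_fderiv isOpen_Ioi (differentiableOn_crossFlowAxial γ) fun r hr => ?_
  have hg : AnalyticAt ℝ (fun s : ℝ => (Real.exp (-(γ * Real.log s ^ 2)) / s) • (1 : ℝ →L[ℝ] ℝ)) r :=
    (analyticAt_axialIntegrand γ hr).smul analyticAt_const
  refine hg.congr ?_
  filter_upwards [Ioi_mem_nhds hr] with s hs
  exact (fderiv_crossFlowAxial γ hs).symm

/-- The axial profile is analytic at every `r > 0`. -/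
theorem analyticAt_crossFlowAxial {r : ℝ} (hr : 0 < r) : AnalyticAt ℝ (crossFlowAxial γ) r :=
  analyticOnNhd_crossFlowAxial γ r hr

/-- **The ODE of the profile**: `g′(r) = −g(r)·(2γ log r + 1)/r` for `g(s) = e^{−γ log²s}/s`, i.e. with `G′ = g`:
`G″ + (1 + 2γ log r) G′/r = 0`. -/
theorem hasDerivAt_axialIntegrand {r : ℝ} (hr : 0 < r) :
    HasDerivAt (fun s : ℝ => Real.exp (-(γ * Real.log s ^ 2)) / s)
      (-(Real.exp (-(γ * Real.log r ^ 2)) / r) * (2 * γ * Real.log r + 1) / r) r := by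
  have h := ((((Real.hasDerivAt_log hr.ne').fun_pow 2).const_mul γ).fun_neg.exp).fun_div (hasDerivAt_id' r) hr.ne'
  refine h.congr_deriv ?_
  norm_num
  field_simp
  ring

end Summit.NavierStokesRegularity.NavierStokesRegularity.Theorems.PoloidalLiouville.AzimuthalCartan.Axial

end
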